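import Summits.Ventures.PercRepro.Night2BasisMass

/-!
# night-2: the face-based mass bound of the basis pairs

For a five-point basis `Q'` with `Q = K ∪ Q'`, the thin covering preimages of `Q` are exactly its good faces
`Q.erase w` (`L1_eq_sum_req_faces`), so the total loss of its pairs is `L1 Q − capS Q ≤ L1 Q − 11/18 ≤ Σ_w (req (Q.erase w) − 11/90)`
— at most `Σ_w phiFace (Q.erase w)` with `phiFace B = max 0 (req B − 11/90)`, positive only at the faces whose closure
misses at most seven points of `G` (`sum_loss_faces_le_phi`).  Regrouping by faces: the basis pairs' mass at `T` is at most
`(1/D) · Σ_{B thin, |B ∖ K| = 4, B ⊆ T} phiFace B · |(T ∖ K) ∖ clF B|` (`pi2MassH_le_face_sum`) — a bound by the sizes of the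
hyperplanes spanned by the four-point members inside `T`, with no reference to lossy bases (paper NIGHT-2-g31 §3.2 (b′);
the assembly is `Night2BasisFaceSum`).
-/

namespace PercRepro.Shadow

open PercRepro.ThmH PercRepro.PerFlat

variable {α : Type*} [DecidableEq α] {M : Matroid α} [M.Finite] {G : Finset α}

/-- The excess request of a face over `11/90` (the fifth of `11/18`), clipped at `0`. -/
noncomputable def phiFace (M : Matroid α) [M.Finite] (B : Finset α) : ℚ := max 0 (req M 5 B - 11 / 90)

/-- `phiFace` is nonnegative. -/
theorem phiFace_nonneg (B : Finset α) : 0 ≤ phiFace M B := le_max_left _ _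

/-- A thin covering preimage of `Q` is a good face `Q.erase w` with `w ∈ Q ∖ K`. -/
theorem exists_faceOk_of_thin_coverPreimage (hG : G ∈ flatsQ M (5 + 1)) (hd : (gr M \ G).card = 2)
    {Q F : Finset α} (hF : F ∈ (coverPreimages M (Uq M (5 + 2) 5) G Q).filter (fun F => F ∉ lay0 M 5 G)) :
    ∃ w ∈ Q \ coloops M G, faceOk M G Q w ∧ F = Q.erase w := by
  have hd' : (gr M \ G).card ≤ 5 := by omega
  have hsub := thin_coverPreimages_subset_image_coloops hG hd' Q
  obtain ⟨w, hw, rfl⟩ := Finset.mem_image.1 (hsub hF)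
  have hwQ : w ∈ Q \ coloops M G := (mem_coloops.1 hw).1
  rw [Finset.mem_filter, mem_coverPreimages] at hF
  refine ⟨w, hwQ, ⟨mem_thinMembers.2 ⟨hF.1.1, hF.2⟩, ?_⟩, rfl⟩
  -- `Q ∈ coverSets (Q.erase w) G`: `Q = insert z (Q.erase w)` with `z ∈ G ∖ clF (Q.erase w)`, and then `z = w`
  unfold coverSets at hF
  obtain ⟨z, hz, hzQ⟩ := Finset.mem_image.1 hF.1.2
  have hzw : z = w := by
    by_contra hne
    have hwQ' : w ∈ Q := (Finset.mem_sdiff.1 hwQ).1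
    have : w ∈ insert z (Q.erase w) := by
      rw [hzQ]
      exact hwQ'
    rw [Finset.mem_insert, Finset.mem_erase] at this
    rcases this with h | h
    · exact hne h.symm
    · exact h.1 rfl
  subst hzw
  exact hz

/-- **`L1 Q` is the sum of the requests of the good faces of `Q`** (over `w ∈ Q ∖ K`). -/
theorem L1_eq_sum_req_faces (hG : G ∈ flatsQ M (5 + 1)) (hd : (gr M \ G).card = 2) (Q : Finset α) :
    L1 M 5 G Q = ∑ w ∈ (Q \ coloops M G).filter (fun w => faceOk M G Q w), req M 5 (Q.erase w) := by
  unfold L1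
  rw [← Finset.sum_image (f := fun F => req M 5 F) (g := fun w => Q.erase w)
    (s := (Q \ coloops M G).filter (fun w => faceOk M G Q w)) (fun w hw w' hw' heq =>
      erase_injOn Q (Finset.mem_sdiff.1 (Finset.mem_filter.1 hw).1).1
        (Finset.mem_sdiff.1 (Finset.mem_filter.1 hw').1).1 heq)]
  congr 1
  ext F
  rw [Finset.mem_image]
  constructor
  · intro hF
    obtain ⟨w, hw, hok, rfl⟩ := exists_faceOk_of_thin_coverPreimage hG hd hF
    exact ⟨w, Finset.mem_filter.2 ⟨hw, hok⟩, rfl⟩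
  · rintro ⟨w, hw, rfl⟩
    rw [Finset.mem_filter] at hw
    exact face_mem_thin_coverPreimages (Finset.mem_sdiff.1 hw.1).1 hw.2

/-- **The losses of the faces of a five-point set are at most the sum of their clipped excesses**:
`Σ loss ≤ L1 − capS ≤ L1 − 11/18 ≤ Σ (req − 11/90) ≤ Σ phiFace` (at most five faces). -/
theorem sum_loss_faces_le_phi (hG : G ∈ flatsQ M (5 + 1)) (hd : (gr M \ G).card = 2) (hk : kColoops M G = 1)
    {Q' : Finset α} (hQ'G : Q' ⊆ G \ coloops M G) (hQ'5 : Q'.card = 5) :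
    ∑ w ∈ Q'.filter (fun w => faceOk M G (coloops M G ∪ Q') w), loss M 5 G ((coloops M G ∪ Q').erase w) w ≤
      ∑ w ∈ Q'.filter (fun w => faceOk M G (coloops M G ∪ Q') w), phiFace M ((coloops M G ∪ Q').erase w) := by
  have hKG : coloops M G ⊆ G := fun y hy => (mem_coloops.1 hy).1
  set Q := coloops M G ∪ Q' with hQ
  have hQG : Q ⊆ G := Finset.union_subset hKG (hQ'G.trans Finset.sdiff_subset)
  have hQK : Q \ coloops M G = Q' := by
    rw [hQ, Finset.union_sdiff_cancel_left]
    rw [Finset.disjoint_left]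
    intro a ha ha'
    exact (Finset.mem_sdiff.1 (hQ'G ha')).2 ha
  set W := Q'.filter (fun w => faceOk M G Q w) with hW
  have hL1 : L1 M 5 G Q = ∑ w ∈ W, req M 5 (Q.erase w) := by
    rw [L1_eq_sum_req_faces hG hd Q, hQK]
  have hcap := capS_ge_eleven_eighteenths_two_one hd hk hQG
  have hfactor : ∑ w ∈ W, loss M 5 G (Q.erase w) w = (1 - fS M 5 G Q) * ∑ w ∈ W, req M 5 (Q.erase w) := by
    rw [Finset.mul_sum]
    apply Finset.sum_congr rfl
    intro w hw
    rw [hW, Finset.mem_filter] at hw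
    unfold loss
    rw [Finset.insert_erase (Finset.mem_union_right _ hw.1)]
    ring
  have hW5 : W.card ≤ 5 := by
    rw [← hQ'5]
    exact Finset.card_le_card (Finset.filter_subset _ _)
  have hphi : ∑ w ∈ W, (req M 5 (Q.erase w) - 11 / 90) ≤ ∑ w ∈ W, phiFace M (Q.erase w) :=
    Finset.sum_le_sum (fun w _ => le_max_right _ _)
  have hsum_sub : ∑ w ∈ W, (req M 5 (Q.erase w) - 11 / 90) = ∑ w ∈ W, req M 5 (Q.erase w) - W.card * (11 / 90) := by
    rw [Finset.sum_sub_distrib, Finset.sum_const, nsmul_eq_mul]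
  have hW5' : (W.card : ℚ) ≤ 5 := by exact_mod_cast hW5
  rw [hfactor]
  unfold fS
  split_ifs with hle
  · simp only [sub_self, zero_mul]
    exact Finset.sum_nonneg (fun w _ => phiFace_nonneg _)
  · push Not at hle
    rw [hL1] at hle ⊢
    have hpos : 0 < ∑ w ∈ W, req M 5 (Q.erase w) := by linarith
    have h1 : (1 - capS M 5 G Q / ∑ w ∈ W, req M 5 (Q.erase w)) * ∑ w ∈ W, req M 5 (Q.erase w) =
        ∑ w ∈ W, req M 5 (Q.erase w) - capS M 5 G Q := by
      field_simp
    rw [h1]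
    linarith

/-- **The face-based mass bound**: the basis pairs' mass at `T` is at most `(1/D)` times the sum over the four-point
thin members `B ⊆ T` of `phiFace B · |(T ∖ K) ∖ clF B|`, `D = 2^(|G| − 6) − 1`. -/
theorem pi2MassH_le_face_sum (hG : G ∈ flatsQ M (5 + 1)) (hd : (gr M \ G).card = 2) (hk : kColoops M G = 1)
    {T : Finset α} (hTG : T ⊆ G) (hKT : coloops M G ⊆ T) :
    pi2MassH M 5 G (bigP M G) T ≤
      (∑ B ∈ (thinMembers M 5 G).filter (fun B => ¬ bigP M G B ∧ B ⊆ T),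
        phiFace M B * (((T \ coloops M G) \ clF M B).card : ℚ)) / ((2 ^ (G.card - 6) - 1 : ℕ) : ℚ) := by
  have hd' : (gr M \ G).card ≤ 5 := by omega
  have hGg : G ⊆ gr M := (mem_flatsQ.1 hG).1
  have hKG : coloops M G ⊆ G := fun y hy => (mem_coloops.1 hy).1
  set D : ℚ := ((2 ^ (G.card - 6) - 1 : ℕ) : ℚ) with hD
  set PP := (((thinMembers M 5 G).filter (fun B => ¬ bigP M G B)).sigma (fun B => G \ clF M B)).filter
    (fun p => T ∈ tgtSets M 5 G p.1 p.2) with hPP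
  have hmass : pi2MassH M 5 G (bigP M G) T = ∑ p ∈ PP, rhoL M 5 G p.1 p.2 := by
    rw [hPP, Finset.sum_filter, Finset.sum_sigma]
    unfold pi2MassH
    rw [Finset.sum_filter]
  have hrho : ∀ p ∈ PP, rhoL M 5 G p.1 p.2 = loss M 5 G p.1 p.2 / D := by
    intro p hp
    rw [hPP, Finset.mem_filter, Finset.mem_sigma, Finset.mem_filter] at hp
    obtain ⟨⟨⟨hB, hnP⟩, hz⟩, -⟩ := hp
    have hB4 := card_sdiff_eq_four_of_not_bigP hG hd hk hB hnP
    unfold rhoL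
    rw [card_tgtSets hG (mem_thinMembers.1 hB).1 hz,
      card_sdiff_insert_eq_dqm1 (ρ := 5) hG hd' hB (by omega) hz, hk]
    have hcard : G.card - 1 - 5 = G.card - 6 := by omega
    rw [hcard]
  set g : (Σ _ : Finset α, α) → (Σ _ : Finset α, α) := fun p => ⟨insert p.2 p.1 \ coloops M G, p.2⟩ with hg
  have hfacts : ∀ p ∈ PP, p.2 ∉ p.1 ∧ p.2 ∉ coloops M G ∧ coloops M G ⊆ p.1 ∧ insert p.2 p.1 ⊆ T ∧
      (p.1 \ coloops M G).card = 4 ∧ p.1 ∈ thinMembers M 5 G ∧ p.2 ∈ G \ clF M p.1 ∧ ¬ bigP M G p.1 := by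
    intro p hp
    rw [hPP, Finset.mem_filter, Finset.mem_sigma, Finset.mem_filter] at hp
    obtain ⟨⟨⟨hB, hnP⟩, hz⟩, hT⟩ := hp
    have hKB : coloops M G ⊆ p.1 := coloops_subset_of_mem_thinMembers hG hd' hB
    have hzB : p.2 ∉ p.1 := fun h => (Finset.mem_sdiff.1 hz).2
      (subset_clF_of_subset_gr ((subset_G_of_mem_thinMembers hB).trans hGg) h)
    exact ⟨hzB, fun h => hzB (hKB h), hKB, (mem_tgtSets.1 hT).2.1, card_sdiff_eq_four_of_not_bigP hG hd hk hB hnP,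
      hB, hz, hnP⟩
  have hinj : Set.InjOn g ↑PP := by
    intro p hp p' hp' heq
    rw [Finset.mem_coe] at hp hp'
    obtain ⟨hzB, hzK, hKB, -, -, -, -, -⟩ := hfacts p hp
    obtain ⟨hzB', hzK', hKB', -, -, -, -, -⟩ := hfacts p' hp'
    simp only [hg, Sigma.mk.injEq] at heq
    obtain ⟨h1, h2⟩ := heq
    have h2' : p.2 = p'.2 := eq_of_heq h2
    rw [Finset.insert_sdiff_of_notMem _ hzK, Finset.insert_sdiff_of_notMem _ hzK', h2'] at h1
    have h3 : p.1 \ coloops M G = p'.1 \ coloops M G := by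
      have := congrArg (fun s => s.erase p'.2) h1
      rwa [Finset.erase_insert (fun h => hzB (h2' ▸ (Finset.mem_sdiff.1 h).1)),
        Finset.erase_insert (fun h => hzB' (Finset.mem_sdiff.1 h).1)] at this
    have h4 : p.1 = p'.1 := by
      rw [← Finset.sdiff_union_of_subset hKB, ← Finset.sdiff_union_of_subset hKB', h3]
    exact Sigma.ext h4 h2
  -- the five-point sets inside `T ∖ K`
  set LB := (T \ coloops M G).powersetCard 5 with hLB
  have hQeq : ∀ p ∈ PP, coloops M G ∪ (g p).1 = insert p.2 p.1 := by
    intro p hp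
    obtain ⟨-, -, hKB, -, -, -, -, -⟩ := hfacts p hp
    simp only [hg]
    exact Finset.union_sdiff_of_subset (hKB.trans (Finset.subset_insert _ _))
  have hloss_eq : ∀ p ∈ PP, loss M 5 G p.1 p.2 = loss M 5 G ((coloops M G ∪ (g p).1).erase (g p).2) (g p).2 := by
    intro p hp
    obtain ⟨hzB, -, -, -, -, -, -, -⟩ := hfacts p hp
    rw [hQeq p hp]
    simp only [hg]
    rw [Finset.erase_insert hzB]
  have hmaps : ∀ p ∈ PP, (g p).1 ∈ LB ∧ (g p).2 ∈ (g p).1 ∧ faceOk M G (coloops M G ∪ (g p).1) (g p).2 := by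
    intro p hp
    obtain ⟨hzB, hzK, hKB, hQT, hB4, hB, hz, -⟩ := hfacts p hp
    have hface : faceOk M G (coloops M G ∪ (g p).1) p.2 := by
      unfold faceOk
      rw [hQeq p hp, Finset.erase_insert hzB]
      exact ⟨hB, hz⟩
    have hmem : p.2 ∈ (g p).1 := by
      simp only [hg]
      exact Finset.mem_sdiff.2 ⟨Finset.mem_insert_self _ _, hzK⟩
    refine ⟨?_, hmem, hface⟩
    rw [hLB, Finset.mem_powersetCard]
    refine ⟨fun a ha => ?_, ?_⟩
    · simp only [hg] at ha
      rw [Finset.mem_sdiff] at ha ⊢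
      exact ⟨hQT ha.1, ha.2⟩
    · simp only [hg]
      rw [Finset.insert_sdiff_of_notMem _ hzK, Finset.card_insert_of_notMem (fun h => hzB (Finset.mem_sdiff.1 h).1), hB4]
  -- Step 1: the pairs' losses are at most the bases' face losses
  have hnn : ∀ q : (Σ _ : Finset α, α), faceOk M G (coloops M G ∪ q.1) q.2 →
      0 ≤ loss M 5 G ((coloops M G ∪ q.1).erase q.2) q.2 := by
    intro q hq
    obtain ⟨hthin, hw⟩ := hq
    exact loss_nonneg (le_trans (by norm_num) (capS_ge_eleven_eighteenths_two_one hd hk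
      (Finset.insert_subset (Finset.mem_sdiff.1 hw).1 (subset_G_of_mem_thinMembers hthin))))
  set SIG := LB.sigma (fun Q' => Q'.filter (fun w => faceOk M G (coloops M G ∪ Q') w)) with hSIG
  have hstep1 : ∑ p ∈ PP, loss M 5 G p.1 p.2 ≤ ∑ q ∈ SIG, loss M 5 G ((coloops M G ∪ q.1).erase q.2) q.2 := by
    rw [Finset.sum_congr rfl hloss_eq, ← Finset.sum_image (f := fun q : (Σ _ : Finset α, α) =>
      loss M 5 G ((coloops M G ∪ q.1).erase q.2) q.2) (g := g) (s := PP) hinj]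
    apply Finset.sum_le_sum_of_subset_of_nonneg
    · intro q hq
      rw [Finset.mem_image] at hq
      obtain ⟨p, hp, rfl⟩ := hq
      obtain ⟨h1, h2, h3⟩ := hmaps p hp
      exact Finset.mem_sigma.2 ⟨h1, Finset.mem_filter.2 ⟨h2, h3⟩⟩
    · intro q hq _
      obtain ⟨-, hq2⟩ := Finset.mem_sigma.1 hq
      exact hnn q (Finset.mem_filter.1 hq2).2
  -- Step 2: per basis, the face losses are at most the clipped excesses
  have hstep2 : ∑ q ∈ SIG, loss M 5 G ((coloops M G ∪ q.1).erase q.2) q.2 ≤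
      ∑ q ∈ SIG, phiFace M ((coloops M G ∪ q.1).erase q.2) := by
    rw [hSIG, Finset.sum_sigma, Finset.sum_sigma]
    apply Finset.sum_le_sum
    intro Q' hQ'
    rw [hLB, Finset.mem_powersetCard] at hQ'
    exact sum_loss_faces_le_phi hG hd hk (hQ'.1.trans (Finset.sdiff_subset_sdiff hTG (Finset.Subset.refl _))) hQ'.2
  -- Step 3: regroup by faces
  set PF := ((thinMembers M 5 G).filter (fun B => ¬ bigP M G B ∧ B ⊆ T)).sigma
    (fun B => (T \ coloops M G) \ clF M B) with hPF
  set h : (Σ _ : Finset α, α) → (Σ _ : Finset α, α) := fun q => ⟨(coloops M G ∪ q.1).erase q.2, q.2⟩ with hh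
  have hinj' : Set.InjOn h ↑SIG := by
    intro q hq q' hq' heq
    rw [Finset.mem_coe] at hq hq'
    obtain ⟨hq1, hq2⟩ := Finset.mem_sigma.1 hq
    obtain ⟨hq1', hq2'⟩ := Finset.mem_sigma.1 hq'
    have hw : q.2 ∈ q.1 := (Finset.mem_filter.1 hq2).1
    have hw' : q'.2 ∈ q'.1 := (Finset.mem_filter.1 hq2').1
    simp only [hh, Sigma.mk.injEq] at heq
    obtain ⟨h1, h2⟩ := heq
    have h2' : q.2 = q'.2 := eq_of_heq h2
    have hQ1 : coloops M G ∪ q.1 = coloops M G ∪ q'.1 := by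
      have := congrArg (insert q'.2) h1
      rwa [← h2', Finset.insert_erase (Finset.mem_union_right _ hw), h2',
        Finset.insert_erase (Finset.mem_union_right _ hw')] at this
    have hsub1 : q.1 ⊆ T \ coloops M G := (Finset.mem_powersetCard.1 (hLB ▸ hq1)).1
    have hsub1' : q'.1 ⊆ T \ coloops M G := (Finset.mem_powersetCard.1 (hLB ▸ hq1')).1
    have hdisj : ∀ {X : Finset α}, X ⊆ T \ coloops M G → (coloops M G ∪ X) \ coloops M G = X := by
      intro X hX
      rw [Finset.union_sdiff_cancel_left]
      rw [Finset.disjoint_left]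
      intro a ha ha'
      exact (Finset.mem_sdiff.1 (hX ha')).2 ha
    have h3 : q.1 = q'.1 := by
      rw [← hdisj hsub1, ← hdisj hsub1', hQ1]
    exact Sigma.ext h3 h2
  have hmaps' : ∀ q ∈ SIG, h q ∈ PF := by
    intro q hq
    obtain ⟨hq1, hq2⟩ := Finset.mem_sigma.1 hq
    rw [Finset.mem_filter] at hq2
    obtain ⟨hw, hthin, hwcl⟩ := hq2
    have hsub1 : q.1 ⊆ T \ coloops M G := (Finset.mem_powersetCard.1 (hLB ▸ hq1)).1
    have hc5 : q.1.card = 5 := (Finset.mem_powersetCard.1 (hLB ▸ hq1)).2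
    rw [hPF, Finset.mem_sigma, Finset.mem_filter]
    simp only [hh]
    refine ⟨⟨hthin, ?_, ?_⟩, ?_⟩
    · -- not big: `(Q.erase w) ∖ K = q.1.erase w` has four points
      unfold bigP
      have heq : ((coloops M G ∪ q.1).erase q.2) \ coloops M G = q.1.erase q.2 := by
        rw [Finset.erase_sdiff_comm, Finset.union_sdiff_cancel_left]
        rw [Finset.disjoint_left]
        intro a ha ha'
        exact (Finset.mem_sdiff.1 (hsub1 ha')).2 ha
      rw [heq, Finset.card_erase_of_mem hw, hc5]
      norm_num
    · exact (Finset.erase_subset _ _).trans (Finset.union_subset hKT (hsub1.trans Finset.sdiff_subset))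
    · rw [Finset.mem_sdiff]
      exact ⟨hsub1 hw, (Finset.mem_sdiff.1 hwcl).2⟩
  have hstep3 : ∑ q ∈ SIG, phiFace M ((coloops M G ∪ q.1).erase q.2) ≤
      ∑ B ∈ (thinMembers M 5 G).filter (fun B => ¬ bigP M G B ∧ B ⊆ T),
        phiFace M B * (((T \ coloops M G) \ clF M B).card : ℚ) := by
    have h1 : ∑ q ∈ SIG, phiFace M ((coloops M G ∪ q.1).erase q.2) = ∑ p ∈ SIG.image h, phiFace M p.1 := by
      rw [Finset.sum_image hinj']
    have h2 : ∑ p ∈ SIG.image h, phiFace M p.1 ≤ ∑ p ∈ PF, phiFace M p.1 := by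
      apply Finset.sum_le_sum_of_subset_of_nonneg
      · intro p hp
        rw [Finset.mem_image] at hp
        obtain ⟨q, hq, rfl⟩ := hp
        exact hmaps' q hq
      · intro p _ _
        exact phiFace_nonneg _
    have h3 : ∑ p ∈ PF, phiFace M p.1 = ∑ B ∈ (thinMembers M 5 G).filter (fun B => ¬ bigP M G B ∧ B ⊆ T),
        phiFace M B * (((T \ coloops M G) \ clF M B).card : ℚ) := by
      rw [hPF, Finset.sum_sigma]
      apply Finset.sum_congr rfl
      intro B _
      simp only [Finset.sum_const, nsmul_eq_mul, mul_comm]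
    rw [h1, ← h3]
    exact h2
  -- assemble
  rw [hmass, Finset.sum_congr rfl hrho, ← Finset.sum_div]
  apply div_le_div_of_nonneg_right _ (by rw [hD]; exact Nat.cast_nonneg _)
  exact hstep1.trans (hstep2.trans hstep3)


end PercRepro.Shadow
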